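/-
Copyright: the b2b-balaban T⁴-continuum CRUX team, row NE7b OWNER lineage `t4-ne7b-p1` (gen 136). Project licence.
-/
import Summits.QuantumFields.BalabanUV.T4Continuum.Spine.NE7b.SupBlockLowerLetterTransfer
import Summits.QuantumFields.BalabanUV.T4Continuum.Spine.NE7b.SupBlockEffectiveActionDerivative
import Summits.QuantumFields.BalabanUV.T4Continuum.Spine.NE7b.SupEffectiveActionLowerLetter

/-!
# THE LOWER SECOND-ORDER LETTER OF THE NEXT POTENTIAL FOR A BLOCK-LOCAL INPUT, ON THE GAUSSIAN ROAD — (318)'s BLOCK TWIN ((398) +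
# (399) + (318)'s dictionary): for a `C¹` block potential `U : ℝ^ι → ℝ` with the two block letters of (399), the LOWER letter in secant form
# (constant `λ ≥ 0`) and a precision `M ≻ 0` with floor `m`, `2λ ≤ m`, `M⁻¹ ⪯ γ_op·1` under the regulator margin: at EVERY `ψ, ψ′`,
#   `W(ψ) + DW(ψ)[ψ′−ψ] − λ·Σ_i(ψ′_i−ψ_i)² ≤ W(ψ′)`,   `W = −log∫e^{−U(ω+·)}dN(0,M⁻¹)`, `DW(ψ) = fderiv ℝ W ψ`
# — Prékopa–Leindler on `ℝ^ι` ((398)) read through the Lebesgue–Gaussian dictionary of (318), secant ⟹ first order by (317) with (399)'s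
# derivative.  With (400): THE TWO-SIDED SECOND-ORDER CLASS PASSES THROUGH THE FLUCTUATION STEP FOR BLOCK-LOCAL INPUTS — (β1)'s analytic
# core (row NE7b, node U5c; (317)∕(318)∕(398)∕(399) BY NAME; [cite: BrascampLieb1976, Thm 4.3]; [folklore])

Cell `pub-balaban`, sub-cell `t4`, spine estimate NE7b (`T4WeightBudget.RelWeightBound`; the cell's OWN estimate — NOT PRINTED in
[Bałaban 1983–89], NOT PROVED).  Crux-route work under `Spine/NE7b/` by the row OWNER (`t4-ne7b-p1` gen 136, file (401)) under FREEZE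
(0)'s crux-prover clause, on this gen's SCOPING-d8 (β1); NOTHING of Bałaban's is named as a Lean object, valued or asserted; no
`T4Continuum/Support` leaf typed; no `def`, no notation; zero `sorry`.  Imports (BY NAME): the OWNER's (398) `…SupBlockLowerLetterTransfer`
(`neg_log_integral_secant`, `block_jointAction_secant`), (399) `…SupBlockEffectiveActionDerivative` (`hasFDerivAt_block_neg_log`,
`integrable_exp_neg_block`), (318) `…SupEffectiveActionLowerLetter` (for the tree's dictionary `gaussProb_eq_map_multivariateGaussian`,
`gaussNorm_pos`, `gaussWeight`), (317) (`firstOrder_of_secant_hasFDerivAt'`).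

WHAT IS PROVED ([folklore]; `Z(ψ) = ∫e^{−U(ω+ψ)}dN(0,M⁻¹)`, `S_ψ(z) = ½⟨z,Mz⟩ + U(z+ψ) + λΣψ_i²` on `ℝ^ι`):
* §1 `measurable_blockJointAction`, `measurable_blockJointAction_exp`, **`lintegral_blockJointAction_eq`** (`∫⁻ofReal(e^{−S_ψ}) = ofReal(e^{−λΣψ²}·gaussNorm M·Z(ψ))`),
  `integrable_blockJointAction_exp`, `integral_blockJointAction_eq` (the real-integral dictionary);
* §2 **`block_gauss_secant`** (`W̃((1−s)ψ₀+sψ₁) ≤ (1−s)W̃(ψ₀) + sW̃(ψ₁)`, `W̃ = −log Z + λΣψ_i²`, `0 ≤ s ≤ 1`);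
* §3 `hasFDerivAt_sq_sum_euclid`, THE END **`block_neg_log_lower_letter`**; §4 toy.

HONEST (what this is NOT).  The lower half on the Gaussian road for block inputs (the upper half is (400)); the secant lower letter of `U`
is a hypothesis (for a `C¹` `U` it is the two-point letter `U(b) ≥ U(a) + U′(a)[b−a] − ½λΣ(b−a)²` — (317) `secant_of_lowerLetter`'s pattern);
no Hessian, no cubic letter for block inputs ((319)∕(337b)'s block twins are the successor's); scalar skeleton ((A3), NC-NE7b-α UNRULED);
nothing of Bałaban's asserted.  BY-NAME EFFECT ON THE WALL: NONE.  NE7b NOT PRINTED ∕ NOT PROVED; spine PROVED 0∕9; rung (B)+1 — the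
programme's measures remain FINITE-torus statements; NOT the mass gap, NOT Clay.  HONEST DEPENDENCY: continuum YM on T⁴ ⇐ BetaPertH ∧ nine
spine estimates (0∕9 proved); BetaPertH ⇐ (D1) ∧ (D4) ∧ CAP+tail; G-an2-4 gates asym, D1 and NE2∕3∕4.
-/

set_option autoImplicit false

noncomputable section

namespace Summit.QuantumFields.BalabanUV.T4Continuum.NE7b.SupBlockLowerLetter

open MeasureTheory ProbabilityTheory Finset Real
open scoped BigOperators ENNReal Matrix
open Literature.MathematicalPhysics.QuantumFieldTheory.Balaban1983to89
open B13GaugeDevices (gaussWeight gaussNorm)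
open B2Eq228Conditioning (gaussProb gaussProb_eq_map_multivariateGaussian gaussNorm_pos gaussWeight_pos measurable_gaussWeight_real)
open SupJointConvexity (firstOrder_of_secant_hasFDerivAt')
open SupBlockLowerLetterTransfer (neg_log_integral_secant block_jointAction_secant)
open SupBlockEffectiveActionDerivative (hasFDerivAt_block_neg_log integrable_exp_neg_block)
open SupEffectiveActionDerivative (mul_opBound_le_of_le)
open SupGaussianRegulator (transpose_eq_of_posSemidef)

variable {ι : Type} [Fintype ι] [DecidableEq ι]

/-! ## §1. The Lebesgue–Gaussian dictionary for a block potential -/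

omit [DecidableEq ι] in
/-- The joint action `S_ψ(z) = ½⟨z,Mz⟩ + U(z+ψ) + λΣψ²` is measurable in `z`. [folklore] -/
theorem measurable_blockJointAction (M : Matrix ι ι ℝ) {U : EuclideanSpace ℝ ι → ℝ} (hUm : Measurable U) (lam : ℝ)
    (ψ : EuclideanSpace ℝ ι) :
    Measurable fun z : ι → ℝ => 1 / 2 * (z ⬝ᵥ (M *ᵥ z)) + U (WithLp.toLp 2 z + ψ) + lam * ∑ i, ψ i ^ 2 := by
  have hq : Measurable fun z : ι → ℝ => 1 / 2 * (z ⬝ᵥ (M *ᵥ z)) := by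
    have he : (fun z : ι → ℝ => 1 / 2 * (z ⬝ᵥ (M *ᵥ z))) = fun z => -Real.log (gaussWeight M z) := by
      funext z
      rw [gaussWeight, Real.log_exp]
      ring
    rw [he]
    exact (measurable_log.comp (measurable_gaussWeight_real M)).neg
  have hV : Measurable fun z : ι → ℝ => U (WithLp.toLp 2 z + ψ) :=
    hUm.comp ((MeasurableEquiv.toLp 2 (ι → ℝ)).measurable.add_const ψ)
  exact (hq.add hV).add measurable_const

omit [DecidableEq ι] in
/-- The Lebesgue integrand `z ↦ ofReal(e^{−S_ψ(z)})` is measurable. [folklore] -/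
theorem measurable_blockJointAction_exp (M : Matrix ι ι ℝ) {U : EuclideanSpace ℝ ι → ℝ} (hUm : Measurable U) (lam : ℝ)
    (ψ : EuclideanSpace ℝ ι) :
    Measurable fun z : ι → ℝ => ENNReal.ofReal (exp (-(1 / 2 * (z ⬝ᵥ (M *ᵥ z)) + U (WithLp.toLp 2 z + ψ) + lam * ∑ i, ψ i ^ 2))) :=
  (measurable_exp.comp (measurable_blockJointAction M hUm lam ψ).neg).ennreal_ofReal

/-- **THE DICTIONARY**: `M ≻ 0`, `e^{−U(ω+ψ)}` integrable for `N(0,M⁻¹)` ⟹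
`∫⁻ofReal(e^{−½⟨z,Mz⟩ − U(z+ψ) − λΣψ²})dz = ofReal(e^{−λΣψ²}·gaussNorm M·∫e^{−U(ω+ψ)}dN(0,M⁻¹))`. [folklore] -/
theorem lintegral_blockJointAction_eq {M : Matrix ι ι ℝ} (hM : M.PosDef) {U : EuclideanSpace ℝ ι → ℝ} (hUm : Measurable U) (lam : ℝ)
    (ψ : EuclideanSpace ℝ ι) (hI : Integrable (fun ω : EuclideanSpace ℝ ι => exp (-U (ω + ψ))) (multivariateGaussian 0 M⁻¹)) :
    ∫⁻ z : ι → ℝ, ENNReal.ofReal (exp (-(1 / 2 * (z ⬝ᵥ (M *ᵥ z)) + U (WithLp.toLp 2 z + ψ) + lam * ∑ i, ψ i ^ 2))) =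
      ENNReal.ofReal (exp (-(lam * ∑ i, ψ i ^ 2)) * gaussNorm M *
        ∫ ω : EuclideanSpace ℝ ι, exp (-U (ω + ψ)) ∂(multivariateGaussian 0 M⁻¹)) := by
  set F : (ι → ℝ) → ℝ := fun z => exp (-U (WithLp.toLp 2 z + ψ)) with hF
  have hFm : Measurable F := measurable_exp.comp (hUm.comp ((MeasurableEquiv.toLp 2 (ι → ℝ)).measurable.add_const ψ)).neg
  have hρm : Measurable fun z : ι → ℝ => ENNReal.ofReal (gaussWeight M z) := (measurable_gaussWeight_real M).ennreal_ofReal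
  have hgN := gaussNorm_pos hM
  have hsplit : ∀ z : ι → ℝ, ENNReal.ofReal (exp (-(1 / 2 * (z ⬝ᵥ (M *ᵥ z)) + U (WithLp.toLp 2 z + ψ) + lam * ∑ i, ψ i ^ 2))) =
      ENNReal.ofReal (exp (-(lam * ∑ i, ψ i ^ 2))) * (ENNReal.ofReal (gaussWeight M z) * ENNReal.ofReal (F z)) := by
    intro z
    rw [← ENNReal.ofReal_mul (gaussWeight_pos M z).le, ← ENNReal.ofReal_mul (exp_pos _).le, gaussWeight, hF, ← exp_add, ← exp_add]
    congr 1
    ring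
  simp_rw [hsplit]
  have hm2 : Measurable fun z : ι → ℝ => ENNReal.ofReal (gaussWeight M z) * ENNReal.ofReal (F z) := hρm.mul hFm.ennreal_ofReal
  rw [lintegral_const_mul _ hm2]
  have hwd : ∫⁻ z : ι → ℝ, ENNReal.ofReal (gaussWeight M z) * ENNReal.ofReal (F z) =
      ∫⁻ z : ι → ℝ, ENNReal.ofReal (F z) ∂(volume.withDensity fun z => ENNReal.ofReal (gaussWeight M z)) := by
    rw [lintegral_withDensity_eq_lintegral_mul _ hρm hFm.ennreal_ofReal]
    rfl
  have hgp : ∫⁻ z : ι → ℝ, ENNReal.ofReal (F z) ∂(gaussProb M) =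
      ENNReal.ofReal (gaussNorm M)⁻¹ * ∫⁻ z : ι → ℝ, ENNReal.ofReal (F z) ∂(volume.withDensity fun z => ENNReal.ofReal (gaussWeight M z)) := by
    rw [gaussProb, lintegral_smul_measure, smul_eq_mul]
  have hwd' : ∫⁻ z : ι → ℝ, ENNReal.ofReal (gaussWeight M z) * ENNReal.ofReal (F z) =
      ENNReal.ofReal (gaussNorm M) * ∫⁻ z : ι → ℝ, ENNReal.ofReal (F z) ∂(gaussProb M) := by
    rw [hwd, hgp, ← mul_assoc, ← ENNReal.ofReal_mul hgN.le, mul_inv_cancel₀ hgN.ne', ENNReal.ofReal_one, one_mul]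
  have hmap : ∫⁻ z : ι → ℝ, ENNReal.ofReal (F z) ∂(gaussProb M) =
      ∫⁻ ω : EuclideanSpace ℝ ι, ENNReal.ofReal (exp (-U (ω + ψ))) ∂(multivariateGaussian 0 M⁻¹) := by
    rw [gaussProb_eq_map_multivariateGaussian hM, lintegral_map_equiv]
    rfl
  rw [hwd', hmap, ← ofReal_integral_eq_lintegral_ofReal hI (ae_of_all _ fun ω => (exp_pos _).le), ← ENNReal.ofReal_mul hgN.le,
    ← ENNReal.ofReal_mul (exp_pos _).le, mul_assoc]

/-- The Lebesgue weight `e^{−S_ψ}` is integrable (its lower integral is the finite dictionary value). [folklore] -/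
theorem integrable_blockJointAction_exp {M : Matrix ι ι ℝ} (hM : M.PosDef) {U : EuclideanSpace ℝ ι → ℝ} (hUm : Measurable U) (lam : ℝ)
    (ψ : EuclideanSpace ℝ ι) (hI : Integrable (fun ω : EuclideanSpace ℝ ι => exp (-U (ω + ψ))) (multivariateGaussian 0 M⁻¹)) :
    Integrable (fun z : ι → ℝ => exp (-(1 / 2 * (z ⬝ᵥ (M *ᵥ z)) + U (WithLp.toLp 2 z + ψ) + lam * ∑ i, ψ i ^ 2))) := by
  have hmeas : Measurable fun z : ι → ℝ => exp (-(1 / 2 * (z ⬝ᵥ (M *ᵥ z)) + U (WithLp.toLp 2 z + ψ) + lam * ∑ i, ψ i ^ 2)) :=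
    measurable_exp.comp (measurable_blockJointAction M hUm lam ψ).neg
  refine ⟨hmeas.aestronglyMeasurable, ?_⟩
  rw [hasFiniteIntegral_iff_ofReal (ae_of_all _ fun z => (exp_pos _).le), lintegral_blockJointAction_eq hM hUm lam ψ hI]
  exact ENNReal.ofReal_lt_top

/-- **The real-integral dictionary**: `∫e^{−S_ψ(z)}dz = e^{−λΣψ²}·gaussNorm M·∫e^{−U(ω+ψ)}dN(0,M⁻¹)`. [folklore] -/
theorem integral_blockJointAction_eq {M : Matrix ι ι ℝ} (hM : M.PosDef) {U : EuclideanSpace ℝ ι → ℝ} (hUm : Measurable U) (lam : ℝ)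
    (ψ : EuclideanSpace ℝ ι) (hI : Integrable (fun ω : EuclideanSpace ℝ ι => exp (-U (ω + ψ))) (multivariateGaussian 0 M⁻¹)) :
    ∫ z : ι → ℝ, exp (-(1 / 2 * (z ⬝ᵥ (M *ᵥ z)) + U (WithLp.toLp 2 z + ψ) + lam * ∑ i, ψ i ^ 2)) =
      exp (-(lam * ∑ i, ψ i ^ 2)) * gaussNorm M * ∫ ω : EuclideanSpace ℝ ι, exp (-U (ω + ψ)) ∂(multivariateGaussian 0 M⁻¹) := by
  have h := lintegral_blockJointAction_eq hM hUm lam ψ hI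
  rw [← ofReal_integral_eq_lintegral_ofReal (integrable_blockJointAction_exp hM hUm lam ψ hI)
    (ae_of_all _ fun z => (exp_pos _).le)] at h
  have hnn : 0 ≤ exp (-(lam * ∑ i, ψ i ^ 2)) * gaussNorm M * ∫ ω : EuclideanSpace ℝ ι, exp (-U (ω + ψ)) ∂(multivariateGaussian 0 M⁻¹) :=
    mul_nonneg (mul_nonneg (exp_pos _).le (gaussNorm_pos hM).le) (integral_nonneg fun ω => (exp_pos _).le)
  exact (ENNReal.ofReal_eq_ofReal_iff (integral_nonneg fun z => (exp_pos _).le) hnn).1 h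

/-! ## §2. The secant letter of `W̃ = −log Z + λΣψ²` on the Gaussian road -/

section Main

variable {M : Matrix ι ι ℝ} {γop m : ℝ} {U : EuclideanSpace ℝ ι → ℝ} {U' : EuclideanSpace ℝ ι → EuclideanSpace ℝ ι →L[ℝ] ℝ}
  {κ₀ κ₁ a lam τ δ θ : ℝ}

/-- **THE SECANT LETTER (Prékopa–Leindler).**  `M ≻ 0` with floor `m·Σz² ≤ ⟨z,Mz⟩`; `U` measurable with stability `−κ₀Σ_Yφ² ≤ U` and
the secant lower letter of constant `λ ≥ 0` (all `s ∈ [0,1]`); `2λ ≤ m`; `M⁻¹ ⪯ γ_op·1`, `0 < τ`, `2κ₀(1+τ)γ_op ≤ θ < 1` ⟹ for all `ψ₀, ψ₁`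
and `0 ≤ s ≤ 1`, with `W̃(ψ) = −log∫e^{−U(ω+ψ)}dN(0,M⁻¹) + λΣ_iψ_i²`: `W̃((1−s)ψ₀ + sψ₁) ≤ (1−s)W̃(ψ₀) + sW̃(ψ₁)`.
[cite: BrascampLieb1976, Thm 4.3] -/
theorem block_gauss_secant (hM : M.PosDef) (hfl : ∀ z : ι → ℝ, m * ∑ i, z i ^ 2 ≤ z ⬝ᵥ (M *ᵥ z))
    (hΓop : (γop • (1 : Matrix ι ι ℝ) - M⁻¹).PosSemidef) (Y : Finset ι) (hUm : Measurable U) (hκ₀ : 0 ≤ κ₀) (hτ : 0 < τ)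
    (hθ1 : θ < 1) (hκθ : 2 * κ₀ * (1 + τ) * γop ≤ θ) (hstab : ∀ φ : EuclideanSpace ℝ ι, -(κ₀ * ∑ x ∈ Y, φ x ^ 2) ≤ U φ)
    (hlam : 0 ≤ lam)
    (hUsec : ∀ s : ℝ, 0 ≤ s → s ≤ 1 → ∀ a b : EuclideanSpace ℝ ι,
      U ((1 - s) • a + s • b) - lam / 2 * (s * (1 - s)) * ∑ i, (a i - b i) ^ 2 ≤ (1 - s) * U a + s * U b)
    (hm : 2 * lam ≤ m) (ψ₀ ψ₁ : EuclideanSpace ℝ ι) {s : ℝ} (hs0 : 0 ≤ s) (hs1 : s ≤ 1) :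
    -log (∫ ω : EuclideanSpace ℝ ι, exp (-U (ω + ((1 - s) • ψ₀ + s • ψ₁))) ∂(multivariateGaussian 0 M⁻¹)) +
        lam * ∑ i, ((1 - s) • ψ₀ + s • ψ₁) i ^ 2 ≤
      (1 - s) * (-log (∫ ω : EuclideanSpace ℝ ι, exp (-U (ω + ψ₀)) ∂(multivariateGaussian 0 M⁻¹)) + lam * ∑ i, ψ₀ i ^ 2) +
        s * (-log (∫ ω : EuclideanSpace ℝ ι, exp (-U (ω + ψ₁)) ∂(multivariateGaussian 0 M⁻¹)) + lam * ∑ i, ψ₁ i ^ 2) := by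
  have hΓ : (M⁻¹).PosSemidef := hM.inv.posSemidef
  have hMT : Mᵀ = M := transpose_eq_of_posSemidef hM.posSemidef
  have hint : ∀ φ : EuclideanSpace ℝ ι, Integrable (fun ω : EuclideanSpace ℝ ι => exp (-U (ω + φ))) (multivariateGaussian 0 M⁻¹) :=
    fun φ => integrable_exp_neg_block hΓ hΓop Y hUm hκ₀ hτ hθ1 hκθ hstab φ
  have hZ : ∀ φ : EuclideanSpace ℝ ι, 0 < ∫ ω : EuclideanSpace ℝ ι, exp (-U (ω + φ)) ∂(multivariateGaussian 0 M⁻¹) :=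
    fun φ => integral_exp_pos (hint φ)
  -- interior case only matters; the endpoints are equalities
  rcases hs0.eq_or_lt with rfl | hs0'
  · simp
  rcases hs1.eq_or_lt' with rfl | hs1'
  · simp
  set ψs : EuclideanSpace ℝ ι := (1 - s) • ψ₀ + s • ψ₁ with hψs
  -- the joint secant letter on the Lebesgue side, for `U ∘ toLp`
  have hsec : ∀ x y : ι → ℝ,
      1 / 2 * (((1 - s) • x + s • y) ⬝ᵥ (M *ᵥ ((1 - s) • x + s • y))) + U (WithLp.toLp 2 ((1 - s) • x + s • y) + ψs) +
          lam * ∑ i, ψs i ^ 2 ≤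
        (1 - s) * (1 / 2 * (x ⬝ᵥ (M *ᵥ x)) + U (WithLp.toLp 2 x + ψ₀) + lam * ∑ i, ψ₀ i ^ 2) +
          s * (1 / 2 * (y ⬝ᵥ (M *ᵥ y)) + U (WithLp.toLp 2 y + ψ₁) + lam * ∑ i, ψ₁ i ^ 2) := fun x y => by
    have h := block_jointAction_secant hMT hfl (fun z : ι → ℝ => U (WithLp.toLp 2 z)) hlam hs0 hs1
      (fun a b => by
        have h := hUsec s hs0 hs1 (WithLp.toLp 2 a) (WithLp.toLp 2 b)
        rw [← WithLp.toLp_smul, ← WithLp.toLp_smul, ← WithLp.toLp_add] at h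
        simpa using h)
      hm x y (WithLp.ofLp ψ₀) (WithLp.ofLp ψ₁)
    have e1 : WithLp.toLp 2 (((1 - s) • x + s • y) + ((1 - s) • WithLp.ofLp ψ₀ + s • WithLp.ofLp ψ₁)) =
        WithLp.toLp 2 ((1 - s) • x + s • y) + ψs := by
      rw [WithLp.toLp_add]
      congr 1
    have e2 : ∀ (z : ι → ℝ) (φ : EuclideanSpace ℝ ι), WithLp.toLp 2 (z + WithLp.ofLp φ) = WithLp.toLp 2 z + φ := fun z φ => by
      rw [WithLp.toLp_add, WithLp.toLp_ofLp]
    have e3 : ∀ i, ((1 - s) • WithLp.ofLp ψ₀ + s • WithLp.ofLp ψ₁) i = ψs i := fun i => by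
      simp only [hψs, Pi.add_apply, Pi.smul_apply, smul_eq_mul, WithLp.ofLp_add, WithLp.ofLp_smul]
    simp only [e1, e2, e3] at h
    exact h
  have hPL := neg_log_integral_secant (measurable_blockJointAction M hUm lam ψ₀) (measurable_blockJointAction M hUm lam ψ₁)
    (measurable_blockJointAction M hUm lam ψs) hs0' hs1'
    (S₀ := fun z : ι → ℝ => 1 / 2 * (z ⬝ᵥ (M *ᵥ z)) + U (WithLp.toLp 2 z + ψ₀) + lam * ∑ i, ψ₀ i ^ 2)
    (S₁ := fun z : ι → ℝ => 1 / 2 * (z ⬝ᵥ (M *ᵥ z)) + U (WithLp.toLp 2 z + ψ₁) + lam * ∑ i, ψ₁ i ^ 2)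
    (Ss := fun z : ι → ℝ => 1 / 2 * (z ⬝ᵥ (M *ᵥ z)) + U (WithLp.toLp 2 z + ψs) + lam * ∑ i, ψs i ^ 2)
    hsec (integrable_blockJointAction_exp hM hUm lam ψ₀ (hint ψ₀)) (integrable_blockJointAction_exp hM hUm lam ψ₁ (hint ψ₁))
    (integrable_blockJointAction_exp hM hUm lam ψs (hint ψs))
  obtain ⟨-, hle⟩ := hPL
  rw [integral_blockJointAction_eq hM hUm lam ψ₀ (hint ψ₀), integral_blockJointAction_eq hM hUm lam ψ₁ (hint ψ₁),
    integral_blockJointAction_eq hM hUm lam ψs (hint ψs)] at hle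
  -- back to logarithms of `Z`
  have hgN := gaussNorm_pos hM
  have elog : ∀ φ : EuclideanSpace ℝ ι, Real.log (exp (-(lam * ∑ i, φ i ^ 2)) * gaussNorm M *
      ∫ ω : EuclideanSpace ℝ ι, exp (-U (ω + φ)) ∂(multivariateGaussian 0 M⁻¹)) =
      -(lam * ∑ i, φ i ^ 2) + Real.log (gaussNorm M) + Real.log (∫ ω : EuclideanSpace ℝ ι, exp (-U (ω + φ)) ∂(multivariateGaussian 0 M⁻¹)) :=
    fun φ => by
      rw [log_mul (mul_pos (exp_pos _) hgN).ne' (hZ φ).ne', log_mul (exp_pos _).ne' hgN.ne', log_exp]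
  rw [elog, elog, elog] at hle
  linarith

/-! ## §3. THE END: the lower first-order letter -/

omit [DecidableEq ι] in
/-- The derivative of `ψ ↦ λΣ_iψ_i²` on `ℝ^ι`. [folklore] -/
theorem hasFDerivAt_sq_sum_euclid (lam : ℝ) (ψ : EuclideanSpace ℝ ι) :
    HasFDerivAt (fun φ : EuclideanSpace ℝ ι => lam * ∑ i, φ i ^ 2)
      (∑ i, (lam * (2 * ψ i)) • (EuclideanSpace.proj i : EuclideanSpace ℝ ι →L[ℝ] ℝ)) ψ := by
  have hfun : (fun φ : EuclideanSpace ℝ ι => lam * ∑ i, φ i ^ 2) = fun φ => ∑ i, lam * φ i ^ 2 := by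
    funext φ; rw [mul_sum]
  rw [hfun]
  refine HasFDerivAt.fun_sum fun i _ => ?_
  have hq : HasDerivAt (fun t : ℝ => lam * t ^ 2) (lam * (2 * ψ i)) (ψ i) := by
    simpa using (hasDerivAt_pow 2 (ψ i)).const_mul lam
  have h := hq.comp_hasFDerivAt ψ (EuclideanSpace.proj i : EuclideanSpace ℝ ι →L[ℝ] ℝ).hasFDerivAt
  exact h

omit [Fintype ι] [DecidableEq ι] in
/-- The shift's derivative applied to `h`. [folklore] -/
theorem sqSumDeriv_apply [Fintype ι] (lam : ℝ) (ψ h : EuclideanSpace ℝ ι) :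
    (∑ i, (lam * (2 * ψ i)) • (EuclideanSpace.proj i : EuclideanSpace ℝ ι →L[ℝ] ℝ)) h = ∑ i, lam * (2 * ψ i) * h i := by
  simp only [_root_.sum_apply, _root_.smul_apply, smul_eq_mul]
  rfl

/-- **THE END — THE LOWER SECOND-ORDER LETTER OF THE NEXT POTENTIAL FOR A BLOCK-LOCAL INPUT.**  `M ≻ 0` with floor `m` and
`M⁻¹ ⪯ γ_op·1`; `U` everywhere differentiable (`HasFDerivAt U (U′ φ) φ`, `U′` continuous) with the two block letters on `Y` (stability `κ₀`,
gradient `κ₁, a`) and the secant lower letter of constant `λ ≥ 0` with `2λ ≤ m`; `0 < τ`, `0 < δ`, `0 < θ < 1`, `(2κ₀(1+τ)+4δ)γ_op ≤ θ` ⟹ at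
EVERY `ψ, ψ′`:  `−log Z(ψ) + (fderiv ℝ (−log Z) ψ)(ψ′−ψ) − λ·Σ_i(ψ′_i−ψ_i)² ≤ −log Z(ψ′)`, `Z(ψ) = ∫e^{−U(ω+ψ)}dN(0,M⁻¹)`. [folklore] -/
theorem block_neg_log_lower_letter (hM : M.PosDef) (hfl : ∀ z : ι → ℝ, m * ∑ i, z i ^ 2 ≤ z ⬝ᵥ (M *ᵥ z))
    (hΓop : (γop • (1 : Matrix ι ι ℝ) - M⁻¹).PosSemidef) (Y : Finset ι)
    (hUd : ∀ φ : EuclideanSpace ℝ ι, HasFDerivAt U (U' φ) φ) (hU'c : Continuous U')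
    (hκ₀ : 0 ≤ κ₀) (hκ₁ : 0 ≤ κ₁) (ha : 0 ≤ a) (hτ : 0 < τ) (hδ : 0 < δ) (hθ0 : 0 < θ) (hθ1 : θ < 1)
    (hκθ : (2 * κ₀ * (1 + τ) + 4 * δ) * γop ≤ θ) (hstab : ∀ φ : EuclideanSpace ℝ ι, -(κ₀ * ∑ x ∈ Y, φ x ^ 2) ≤ U φ)
    (hU'b : ∀ φ : EuclideanSpace ℝ ι, ‖U' φ‖ ≤ κ₁ * (a + ∑ x ∈ Y, φ x ^ 2)) (hlam : 0 ≤ lam)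
    (hUsec : ∀ s : ℝ, 0 ≤ s → s ≤ 1 → ∀ a b : EuclideanSpace ℝ ι,
      U ((1 - s) • a + s • b) - lam / 2 * (s * (1 - s)) * ∑ i, (a i - b i) ^ 2 ≤ (1 - s) * U a + s * U b)
    (hm : 2 * lam ≤ m) (ψ ψ' : EuclideanSpace ℝ ι) :
    -log (∫ ω : EuclideanSpace ℝ ι, exp (-U (ω + ψ)) ∂(multivariateGaussian 0 M⁻¹)) +
        fderiv ℝ (fun φ : EuclideanSpace ℝ ι => -log (∫ ω : EuclideanSpace ℝ ι, exp (-U (ω + φ)) ∂(multivariateGaussian 0 M⁻¹))) ψ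
          (ψ' - ψ) - lam * ∑ i, (ψ' i - ψ i) ^ 2 ≤
      -log (∫ ω : EuclideanSpace ℝ ι, exp (-U (ω + ψ')) ∂(multivariateGaussian 0 M⁻¹)) := by
  have hΓ : (M⁻¹).PosSemidef := hM.inv.posSemidef
  have hUc : Continuous U := continuous_iff_continuousAt.2 fun φ => (hUd φ).continuousAt
  have hUm : Measurable U := hUc.measurable
  have hκθ₁ : 2 * κ₀ * (1 + τ) * γop ≤ θ := mul_opBound_le_of_le (by positivity) (by linarith) hθ0.le hκθ
  -- the derivative of `W̃ = −log Z + λΣψ²`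
  have hd := (hasFDerivAt_block_neg_log hΓ hΓop Y hUd hU'c hκ₀ hκ₁ ha hτ hδ hθ0 hθ1 hκθ hstab hU'b ψ).add
    (hasFDerivAt_sq_sum_euclid lam ψ)
  -- secant ⟹ first order, with zero gain
  have key := firstOrder_of_secant_hasFDerivAt' (μ := 0) (R := 0) hd fun s hs0 hs1 => by
    have h := block_gauss_secant hM hfl hΓop Y hUm hκ₀ hτ hθ1 hκθ₁ hstab hlam hUsec hm ψ ψ' hs0.le hs1.le
    have e : ψ + s • (ψ' - ψ) = (1 - s) • ψ + s • ψ' := by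
      rw [smul_sub, sub_smul, one_smul]; abel
    rw [e]
    simp only [Pi.add_apply]
    linarith
  simp only [Pi.add_apply, _root_.add_apply, zero_div, zero_mul, add_zero] at key
  rw [sqSumDeriv_apply] at key
  rw [(hasFDerivAt_block_neg_log hΓ hΓop Y hUd hU'c hκ₀ hκ₁ ha hτ hδ hθ0 hθ1 hκθ hstab hU'b ψ).fderiv]
  have hsq : lam * ∑ i, ψ' i ^ 2 - lam * ∑ i, ψ i ^ 2 - ∑ i, lam * (2 * ψ i) * (ψ' - ψ) i = lam * ∑ i, (ψ' i - ψ i) ^ 2 := by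
    simp only [mul_sum, ← sum_sub_distrib, WithLp.ofLp_sub, Pi.sub_apply]
    exact sum_congr rfl fun i _ => by ring
  linarith [hsq]

end Main

/-! ## §4. Toy -/

/-- Toy (§3): the shift's derivative applied to `h` on a one-site lattice. -/
example (ψ h : EuclideanSpace ℝ (Fin 1)) :
    (∑ i, ((2 : ℝ) * (2 * ψ i)) • (EuclideanSpace.proj i : EuclideanSpace ℝ (Fin 1) →L[ℝ] ℝ)) h = ∑ i, (2 : ℝ) * (2 * ψ i) * h i :=
  sqSumDeriv_apply 2 ψ h

end Summit.QuantumFields.BalabanUV.T4Continuum.NE7b.SupBlockLowerLetter
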